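import Summits.BirchSwinnertonDyer.BirchSwinnertonDyer.Theorems.SmallImageMuTransferMuTransferX9SmallImageGenerator
import Literature.NumberTheory.EllipticCurves.IwasawaTwistModPDual
import HarnessLib

/-!
# Step 1 of the `μ`-transfer core (`stub_coreX9`, crux 19276): the images of the test classes

HOME/koly/MU-TRANSFER-PROOF.md §5, STEP 1 / CORE-PLAN §3, on the GENUINE `𝒯_J(E)`
(`WeierstrassCurve.modPTwist W p κ J`): by Lemma 3(i) (tree
`LevelE.modPTwist_stable_addSubgroup_eq_tPow_of_irr_of_not_surj`) a `Γ_ℚ`-stable additive subgroup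
`N ⊂ 𝒯_J` is `T^j 𝒯_J`; so
* `h mod T ≠ 0` forces `im h = 𝒯_J`: a stable `N` containing a vector with non-zero constant
  coefficient is all of `𝒯_J` (`modPTwist_stable_addSubgroup_eq_top_of_apply_zero_ne_zero`);
* `T^{J−1} h^* ≠ 0` forces `im h^* = 𝒯_J^*`: `T^{J−1} x ≠ 0 ↔ x₀ ≠ 0`
  (`shiftEnd_pow_pred_ne_zero_iff`), and the dual deformation `𝒯_J^*` is the twist by `κ⁻¹ =
  κ.invTwist` (tree `ZpExtension.twistDualMap`), again a `ZpExtension`, with top generator `γ⁻¹`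
  (`isTopGenerator_invTwist_inv`), so the first bullet applies to it verbatim
  (`invTwist_modPTwist_stable_addSubgroup_eq_top_of_shiftEnd_pow_ne_zero`).
These are the hypotheses `h1`, `h2'` ("both projections onto") of the kernel schema
`LevelE.theoremA_contradiction_schema` for the joint image `M = im(h, h^*)`.

PARTITION (D-0054): X9 (A4) — helper toward `stub_coreX9`; closes none.
-/

set_option linter.dupNamespace false

noncomputable section

open Literature.NumberTheory.EllipticCurves Literature.NumberTheory.GaloisRepresentations Field

universe u

namespace Summit.BirchSwinnertonDyer.BirchSwinnertonDyer.Rank1Residual.LevelE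

section general

variable {F : Type u} [Field F] {p : ℕ} [Fact p.Prime] (κ : ZpExtension F p)

/-- If `γ` is a topological generator for `κ` (`κ γ = 1`), then `γ⁻¹` is one for the inverse twist
`κ⁻¹ = κ.invTwist` (`κ⁻¹(γ⁻¹) = -(-1) = 1`). [cite: Washington1997, §13.1–§13.2] -/
theorem isTopGenerator_invTwist_inv {γ : absoluteGaloisGroup F} (hγ : κ.IsTopGenerator γ) :
    κ.invTwist.IsTopGenerator γ⁻¹ := by
  unfold ZpExtension.IsTopGenerator at hγ ⊢
  apply Multiplicative.toAdd.injective
  rw [ZpExtension.toAdd_invTwist_apply, map_inv, toAdd_inv, neg_neg, hγ]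

variable {M : Type u} [AddCommGroup M] (J : ℕ)

/-- `T^{J−1} x ≠ 0 ↔ x₀ ≠ 0` in `𝒯_J = M^J` (`(S^{J−1} x)_{J−1} = x₀`, all other coordinates `0`).
[cite: Washington1997, §13.1–§13.2] -/
theorem shiftEnd_pow_pred_ne_zero_iff (hJ : 1 ≤ J) (x : Fin J → M) :
    (shiftEnd M J ^ (J - 1)) x ≠ 0 ↔ x ⟨0, hJ⟩ ≠ 0 := by
  rw [not_iff_not]
  constructor
  · intro h
    have h' := congrFun h ⟨J - 1, by omega⟩
    rw [shiftEnd_pow_apply, Pi.zero_apply, dif_neg (lt_irrefl _)] at h'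
    rw [← h']
    congr 1
    exact Fin.ext (by simp)
  · intro h
    funext i
    rw [shiftEnd_pow_apply, Pi.zero_apply]
    split_ifs with hi
    · rfl
    · have : (⟨(i : ℕ) - (J - 1), by omega⟩ : Fin J) = ⟨0, hJ⟩ := Fin.ext (by simp; omega)
      rw [this, h]

end general

variable (W : WeierstrassCurve ℚ) [W.IsElliptic] (p : ℕ) [Fact p.Prime] (κ : ZpExtension ℚ p) (J : ℕ)

/-- **`h mod T ≠ 0 ⟹ im h = 𝒯_J` (MU-TRANSFER-PROOF §5 STEP 1).** Under `Irr ∧ ¬Surj`: a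
`Γ_ℚ`-stable additive subgroup of the genuine `𝒯_J(E)` containing a vector with non-zero constant
coefficient is everything (Lemma 3(i): it is `T^j 𝒯_J`, and `j ≥ 1` would kill the constant
coefficient). [cite: Serre1972, §2.4 Prop. 15] -/
theorem modPTwist_stable_addSubgroup_eq_top_of_apply_zero_ne_zero
    (hirr : W.HasIrreducibleModPGaloisRep p) (hns : ¬ W.HasSurjectiveModNGaloisRep p) (hJ : 1 ≤ J)
    {γ : absoluteGaloisGroup ℚ} (hγ : κ.IsTopGenerator γ)
    (N : AddSubgroup (Fin J → WeierstrassCurve.geomTorsion W (p : ℤ)))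
    (hN : ∀ (σ : absoluteGaloisGroup ℚ) (x : Fin J → WeierstrassCurve.geomTorsion W (p : ℤ)),
      x ∈ N → W.modPTwist p κ J σ x ∈ N)
    (h0 : ∃ x ∈ N, x ⟨0, hJ⟩ ≠ 0) : N = ⊤ := by
  obtain ⟨j, -, hiff⟩ :=
    modPTwist_stable_addSubgroup_eq_tPow_of_irr_of_not_surj W p κ J hirr hns hJ hγ N hN
  obtain ⟨x, hxN, hx0⟩ := h0
  have hj : j = 0 := by
    by_contra hj
    exact hx0 ((hiff x).mp hxN ⟨0, hJ⟩ (Nat.pos_of_ne_zero hj))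
  refine (AddSubgroup.eq_top_iff' N).mpr fun y => (hiff y).mpr fun i hi => ?_
  rw [hj] at hi
  exact absurd hi (Nat.not_lt_zero _)

/-- **`T^{J−1} h ≠ 0 ⟹ im h = 𝒯_J`.** The same with the hypothesis "some `x ∈ N` has `T^{J−1}x ≠ 0`".
[cite: Serre1972, §2.4 Prop. 15] -/
theorem modPTwist_stable_addSubgroup_eq_top_of_shiftEnd_pow_ne_zero
    (hirr : W.HasIrreducibleModPGaloisRep p) (hns : ¬ W.HasSurjectiveModNGaloisRep p) (hJ : 1 ≤ J)
    {γ : absoluteGaloisGroup ℚ} (hγ : κ.IsTopGenerator γ)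
    (N : AddSubgroup (Fin J → WeierstrassCurve.geomTorsion W (p : ℤ)))
    (hN : ∀ (σ : absoluteGaloisGroup ℚ) (x : Fin J → WeierstrassCurve.geomTorsion W (p : ℤ)),
      x ∈ N → W.modPTwist p κ J σ x ∈ N)
    (h0 : ∃ x ∈ N, (shiftEnd (WeierstrassCurve.geomTorsion W (p : ℤ)) J ^ (J - 1)) x ≠ 0) : N = ⊤ := by
  obtain ⟨x, hxN, hx⟩ := h0
  exact modPTwist_stable_addSubgroup_eq_top_of_apply_zero_ne_zero W p κ J hirr hns hJ hγ N hN
    ⟨x, hxN, (shiftEnd_pow_pred_ne_zero_iff J hJ x).mp hx⟩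

/-- **`T^{J−1} h^* ≠ 0 ⟹ im h^* = 𝒯_J^*` (MU-TRANSFER-PROOF §5 STEP 1, dual side).** The dual
deformation `𝒯_J^* = 𝒯_J(E)` twisted by `κ⁻¹` (tree `ZpExtension.twistDualMap`, `invTwist`) is the
genuine `𝒯_J` of the `ℤ_p`-extension `κ.invTwist`, to which Lemma 3(i) applies with the top generator
`γ⁻¹`: a `Γ_ℚ`-stable additive subgroup containing an `x` with `T^{J−1} x ≠ 0` is everything.
[cite: Serre1972, §2.4 Prop. 15] [cite: Washington1997, §13.1–§13.2] -/
theorem invTwist_modPTwist_stable_addSubgroup_eq_top_of_shiftEnd_pow_ne_zero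
    (hirr : W.HasIrreducibleModPGaloisRep p) (hns : ¬ W.HasSurjectiveModNGaloisRep p) (hJ : 1 ≤ J)
    {γ : absoluteGaloisGroup ℚ} (hγ : κ.IsTopGenerator γ)
    (N : AddSubgroup (Fin J → WeierstrassCurve.geomTorsion W (p : ℤ)))
    (hN : ∀ (σ : absoluteGaloisGroup ℚ) (x : Fin J → WeierstrassCurve.geomTorsion W (p : ℤ)),
      x ∈ N → W.modPTwist p κ.invTwist J σ x ∈ N)
    (h0 : ∃ x ∈ N, (shiftEnd (WeierstrassCurve.geomTorsion W (p : ℤ)) J ^ (J - 1)) x ≠ 0) : N = ⊤ :=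
  modPTwist_stable_addSubgroup_eq_top_of_shiftEnd_pow_ne_zero W p κ.invTwist J hirr hns hJ
    (isTopGenerator_invTwist_inv κ hγ) N hN h0

end Summit.BirchSwinnertonDyer.BirchSwinnertonDyer.Rank1Residual.LevelE

end
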